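import Mathlib
import HarnessLib
import Literature.Probability.MarkovChains.DistinguishingStatistic

/-!
# Positive correlations: Chebyshev, products, Harris, FKG (Levin–Peres–Wilmer §22.4; FKG 1971)

HONEST FRAMING: exact (Metropolis-corrected) sampling algorithms for lattice gauge theory; figures
of merit are autocorrelation/cost numbers at stated couplings and volumes; no continuum-physics claim.

Conventions of `DistinguishingStatistic.lean` (`lawMean μ f = E_μ f = Σ_x μ(x) f(x)`).  Finite state
space `X` carrying a preorder (the book's partial order `⪯`), laws `μ : X → ℝ`.  Sources: D. A. Levin,
Y. Peres (with E. L. Wilmer), *Markov Chains and Mixing Times*, 2nd ed., AMS 2017 [LevinPeres2017],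
§22.4 "Positive Correlations", pp. 309–310 (read from the author-hosted copy); C. M. Fortuin,
P. W. Kasteleyn, J. Ginibre, *Correlation inequalities on some partially ordered sets*, Comm. Math.
Phys. 22 (1971) 89–103 [FortuinKasteleynGinibreCMP1971], §2 Proposition 1 (p. 91, read).  Everything
is PROVED (0 named facts); the lattice-theoretic core of FKG's Proposition 1 is Mathlib's
four-functions theorem (`fkg`, Ahlswede–Daykin), to which the general-sign statement is reduced here.

* `HasPositiveCorrelations μ` — **positive correlations** of a law on a (pre)ordered set:
  `E_μ(fg) ≥ E_μ(f) E_μ(g)` for all increasing `f, g` [cite: LevinPeres2017, §22.4 eq. (22.2)];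
* **FKG, PROPOSITION 1** `FortuinKasteleynGinibre1971_prop_1` — on a finite distributive lattice, a
  non-negative weight `μ` with `μ(x ∧ y) μ(x ∨ y) ≥ μ(x) μ(y)` satisfies
  `(Σ μ)(Σ μ fg) ≥ (Σ μ f)(Σ μ g)` for increasing (or, `_antitone`, decreasing) `f, g`, i.e.
  `⟨fg⟩ ≥ ⟨f⟩⟨g⟩` for the normalised averages [cite: FortuinKasteleynGinibreCMP1971, §2 Prop. 1,
  condition (A) eq. (2.1) and eq. (2.2)]; probability form `FortuinKasteleynGinibre1971_prop_1_prob`;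
* **LEMMA 22.12 (Chebyshev)** `LevinPeres2017_lemma_22_12` — on a totally ordered `X` every probability
  vector has positive correlations, by the book's two-independent-copies computation
  `0 ≤ Σ_{x,y} μ(x)μ(y)(f(x) − f(y))(g(x) − g(y))` [cite: LevinPeres2017, §22.4 Lemma 22.12];
* **LEMMA 22.13** `LevinPeres2017_lemma_22_13` — if `μ` on `X` and `ν` on `Y` (non-negative) have
  positive correlations then so does `μ × ν` on `X × Y` with the coordinate-wise order
  [cite: LevinPeres2017, §22.4 Lemma 22.13, eqs. (22.3)–(22.5)];
* **LEMMA 22.14 (Harris inequality)** `LevinPeres2017_lemma_22_14` — a product probability on a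
  product `Π_i X_i` of totally ordered finite sets, with the coordinate-wise order, has positive
  correlations [cite: LevinPeres2017, §22.4 Lemma 22.14] — DECLARED DEVIATION: the book inducts on
  Lemma 22.13; here the product weight satisfies FKG's condition (A) with equality
  (`prod_weight_latticeCondition`: coordinate-wise `{x_i ∧ y_i, x_i ∨ y_i} = {x_i, y_i}` on a chain),
  so Proposition 1 applies — the route FKG themselves note ("Harris' inequality as special case",
  §1 of the paper).

Context (cell pub-lqcd, venture LatticeQCDFlow): positive correlations of product / Gibbs laws is the
input of the monotone-chain toolbox (Theorem 22.16, censoring) for heat-bath samplers of ferromagnetic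
lattice models, and the reason increasing observables of such samplers have non-negative covariances.
-/

namespace Literature.Probability.MarkovChains

open Finset

variable {X : Type*} [Fintype X]

/-! ## The definition -/

section Defs

variable [Preorder X]

/-- **Positive correlations** of a law `μ` on a (pre)ordered finite set: for all increasing `f, g`,
`Σ_x f(x)g(x)μ(x) ≥ (Σ_x f(x)μ(x))(Σ_x g(x)μ(x))` (stated, as in the book, for probability vectors
`μ`; for a general non-negative weight the left side carries the factor `Σ μ`, see
`FortuinKasteleynGinibre1971_prop_1`). [cite: LevinPeres2017, §22.4 eq. (22.2)] -/
def HasPositiveCorrelations (μ : X → ℝ) : Prop :=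
  ∀ f g : X → ℝ, Monotone f → Monotone g →
    lawMean μ f * lawMean μ g ≤ lawMean μ (fun x => f x * g x)

/-- Shifting the test functions by constants: if the (unnormalised) correlation inequality
`(Σ μ f)(Σ μ g) ≤ (Σ μ)(Σ μ fg)` holds for all NON-NEGATIVE increasing `f, g`, it holds for all
increasing `f, g` (replace `f, g` by `f + c, g + d ≥ 0`; both sides change by the same amount).
[cite: FortuinKasteleynGinibreCMP1971, §2 (remarks before the proof of Prop. 1: (2.2) is unchanged
under `f ↦ f + const`)] -/
theorem sum_mul_sum_le_of_nonneg_test {μ : X → ℝ}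
    (h : ∀ f g : X → ℝ, (∀ x, 0 ≤ f x) → (∀ x, 0 ≤ g x) → Monotone f → Monotone g →
      (∑ x, μ x * f x) * (∑ x, μ x * g x) ≤ (∑ x, μ x) * ∑ x, μ x * (f x * g x))
    {f g : X → ℝ} (hf : Monotone f) (hg : Monotone g) :
    (∑ x, μ x * f x) * (∑ x, μ x * g x) ≤ (∑ x, μ x) * ∑ x, μ x * (f x * g x) := by
  -- constants making `f + c`, `g + d` non-negative
  set c : ℝ := ∑ x, |f x| with hc
  set d : ℝ := ∑ x, |g x| with hd
  have hfc : ∀ x, 0 ≤ f x + c := fun x => by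
    have h1 : |f x| ≤ c := single_le_sum (f := fun y => |f y|) (fun y _ => abs_nonneg _) (mem_univ x)
    have h2 : -f x ≤ |f x| := neg_le_abs (f x)
    linarith
  have hgd : ∀ x, 0 ≤ g x + d := fun x => by
    have h1 : |g x| ≤ d := single_le_sum (f := fun y => |g y|) (fun y _ => abs_nonneg _) (mem_univ x)
    have h2 : -g x ≤ |g x| := neg_le_abs (g x)
    linarith
  have hmain := h (fun x => f x + c) (fun x => g x + d) hfc hgd
    (fun x y hxy => by simpa using hf hxy) (fun x y hxy => by simpa using hg hxy)
  -- expand both sides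
  have e1 : ∑ x, μ x * (f x + c) = ∑ x, μ x * f x + c * ∑ x, μ x := by
    rw [mul_sum, ← sum_add_distrib]; exact sum_congr rfl fun x _ => by ring
  have e2 : ∑ x, μ x * (g x + d) = ∑ x, μ x * g x + d * ∑ x, μ x := by
    rw [mul_sum, ← sum_add_distrib]; exact sum_congr rfl fun x _ => by ring
  have e3 : ∑ x, μ x * ((f x + c) * (g x + d))
      = ∑ x, μ x * (f x * g x) + d * ∑ x, μ x * f x + c * ∑ x, μ x * g x + c * d * ∑ x, μ x := by
    rw [mul_sum, mul_sum, mul_sum, ← sum_add_distrib, ← sum_add_distrib, ← sum_add_distrib]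
    exact sum_congr rfl fun x _ => by ring
  rw [e1, e2, e3] at hmain
  nlinarith [hmain]

end Defs

/-! ## The FKG inequality (Fortuin–Kasteleyn–Ginibre 1971, Proposition 1) -/

section FKG

variable [DistribLattice X]

/-- **FKG inequality (Fortuin–Kasteleyn–Ginibre 1971, PROPOSITION 1).**  Let `X` be a finite
distributive lattice and `μ ≥ 0` a weight satisfying condition (A): `μ(x ∧ y) μ(x ∨ y) ≥ μ(x) μ(y)`
for all `x, y`.  Then for increasing `f, g`, `(Σ μ)(Σ μ fg) ≥ (Σ μ f)(Σ μ g)` — i.e.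
`⟨fg⟩ − ⟨f⟩⟨g⟩ ≥ 0` for the averages `⟨f⟩ = Z⁻¹ Σ f μ`, `Z = Σ μ`.  The non-negative case is Mathlib's
`fkg` (four-functions theorem); general `f, g` by the constant shift.
[cite: FortuinKasteleynGinibreCMP1971, §2 Prop. 1 (condition (A) eq. (2.1), conclusion eq. (2.2))] -/
theorem FortuinKasteleynGinibre1971_prop_1 {μ : X → ℝ} (hμ0 : ∀ x, 0 ≤ μ x)
    (hA : ∀ x y, μ x * μ y ≤ μ (x ⊓ y) * μ (x ⊔ y)) {f g : X → ℝ} (hf : Monotone f)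
    (hg : Monotone g) :
    (∑ x, μ x * f x) * (∑ x, μ x * g x) ≤ (∑ x, μ x) * ∑ x, μ x * (f x * g x) := by
  refine sum_mul_sum_le_of_nonneg_test (fun f g hf0 hg0 hf hg => ?_) hf hg
  exact fkg (μ := μ) (f := f) (g := g) (fun x => hμ0 x) (fun x => hf0 x) (fun x => hg0 x) hf hg hA

/-- **FKG, PROPOSITION 1, "(or decreasing)"**: the same conclusion for two decreasing `f, g`
(apply the increasing case to `−f, −g`). [cite: FortuinKasteleynGinibreCMP1971, §2 Prop. 1 ("Let `f`
and `g` be both increasing (or decreasing) functions")] -/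
theorem FortuinKasteleynGinibre1971_prop_1_antitone {μ : X → ℝ} (hμ0 : ∀ x, 0 ≤ μ x)
    (hA : ∀ x y, μ x * μ y ≤ μ (x ⊓ y) * μ (x ⊔ y)) {f g : X → ℝ} (hf : Antitone f)
    (hg : Antitone g) :
    (∑ x, μ x * f x) * (∑ x, μ x * g x) ≤ (∑ x, μ x) * ∑ x, μ x * (f x * g x) := by
  have h := FortuinKasteleynGinibre1971_prop_1 hμ0 hA (f := fun x => -f x) (g := fun x => -g x)
    (fun x y hxy => neg_le_neg (hf hxy)) (fun x y hxy => neg_le_neg (hg hxy))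
  simpa only [mul_neg, sum_neg_distrib, neg_mul_neg, neg_mul, neg_neg] using h

/-- **FKG, probability form**: a probability vector on a finite distributive lattice satisfying
condition (A) has positive correlations in the sense of (22.2).
[cite: FortuinKasteleynGinibreCMP1971, §2 Prop. 1 with eq. (1.2) (`⟨f⟩ = Z⁻¹ Σ f μ`, here `Z = 1`)] -/
theorem FortuinKasteleynGinibre1971_prop_1_prob {μ : X → ℝ} (hμ0 : ∀ x, 0 ≤ μ x)
    (hμ1 : ∑ x, μ x = 1) (hA : ∀ x y, μ x * μ y ≤ μ (x ⊓ y) * μ (x ⊔ y)) :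
    HasPositiveCorrelations μ := by
  intro f g hf hg
  have h := FortuinKasteleynGinibre1971_prop_1 hμ0 hA hf hg
  simpa only [lawMean, hμ1, one_mul] using h

end FKG

/-! ## Lemma 22.12 (Chebyshev): total orders -/

section Chebyshev

variable [LinearOrder X]

omit [Fintype X] in
/-- On a chain, `(f(x) − f(y))(g(x) − g(y)) ≥ 0` for increasing `f, g` ("the events `{f(X) ≤ f(Y)}`
and `{g(X) ≤ g(Y)}` coincide"). [cite: LevinPeres2017, §22.4, proof of Lemma 22.12] -/
theorem sub_mul_sub_nonneg_of_monotone {f g : X → ℝ} (hf : Monotone f) (hg : Monotone g) (x y : X) :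
    0 ≤ (f x - f y) * (g x - g y) := by
  rcases le_total x y with h | h
  · exact mul_nonneg_of_nonpos_of_nonpos (sub_nonpos.mpr (hf h)) (sub_nonpos.mpr (hg h))
  · exact mul_nonneg (sub_nonneg.mpr (hf h)) (sub_nonneg.mpr (hg h))

/-- **LEMMA 22.12 (Chebyshev), unnormalised**: on a totally ordered finite set, every weight `μ ≥ 0`
satisfies `(Σ μ f)(Σ μ g) ≤ (Σ μ)(Σ μ fg)` for increasing `f, g` — expectation of
`(f(X) − f(Y))(g(X) − g(Y)) ≥ 0` over two independent copies. [cite: LevinPeres2017, §22.4 Lemma 22.12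
(proof: "Taking expectations shows …")] -/
theorem LevinPeres2017_lemma_22_12_sum {μ : X → ℝ} (hμ0 : ∀ x, 0 ≤ μ x) {f g : X → ℝ}
    (hf : Monotone f) (hg : Monotone g) :
    (∑ x, μ x * f x) * (∑ x, μ x * g x) ≤ (∑ x, μ x) * ∑ x, μ x * (f x * g x) := by
  have hkey : 0 ≤ ∑ x, ∑ y, μ x * μ y * ((f x - f y) * (g x - g y)) :=
    sum_nonneg fun x _ => sum_nonneg fun y _ =>
      mul_nonneg (mul_nonneg (hμ0 x) (hμ0 y)) (sub_mul_sub_nonneg_of_monotone hf hg x y)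
  -- expand the double sum: `2 (Σμ)(Σ μ f g) − 2 (Σ μ f)(Σ μ g)`
  have hexp : ∑ x, ∑ y, μ x * μ y * ((f x - f y) * (g x - g y))
      = 2 * ((∑ x, μ x) * ∑ x, μ x * (f x * g x)) - 2 * ((∑ x, μ x * f x) * ∑ x, μ x * g x) := by
    have e : ∀ x y, μ x * μ y * ((f x - f y) * (g x - g y))
        = μ x * (f x * g x) * μ y + μ x * (μ y * (f y * g y))
          - μ x * f x * (μ y * g y) - μ x * g x * (μ y * f y) := fun x y => by ring
    simp_rw [e, sum_sub_distrib, sum_add_distrib, ← mul_sum, ← sum_mul]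
    ring
  rw [hexp] at hkey
  linarith

/-- **LEMMA 22.12 (Chebyshev).**  If `X` is totally ordered, then any probability measure on `X` has
positive correlations. [cite: LevinPeres2017, §22.4 Lemma 22.12] -/
theorem LevinPeres2017_lemma_22_12 {μ : X → ℝ} (hμ0 : ∀ x, 0 ≤ μ x) (hμ1 : ∑ x, μ x = 1) :
    HasPositiveCorrelations μ := by
  intro f g hf hg
  have h := LevinPeres2017_lemma_22_12_sum hμ0 hf hg
  simpa only [lawMean, hμ1, one_mul] using h

end Chebyshev

/-! ## Lemma 22.13: products of two positively correlated laws -/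

section Product

variable {Y : Type*} [Fintype Y] [Preorder X] [Preorder Y]

omit [Fintype Y] [Preorder X] [Preorder Y] in
/-- `E_μ` is monotone in the integrand for `μ ≥ 0`. [folklore] -/
private theorem lawMean_mono {μ : X → ℝ} (hμ0 : ∀ x, 0 ≤ μ x) {f g : X → ℝ} (h : ∀ x, f x ≤ g x) :
    lawMean μ f ≤ lawMean μ g :=
  sum_le_sum fun x _ => mul_le_mul_of_nonneg_left (h x) (hμ0 x)

omit [Preorder X] [Preorder Y] in
/-- Fubini for the product weight: `E_{μ×ν} h = E_ν (y ↦ E_μ h(·,y))`. [folklore] -/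
private theorem lawMean_prod (μ : X → ℝ) (ν : Y → ℝ) (h : X × Y → ℝ) :
    lawMean (fun p : X × Y => μ p.1 * ν p.2) h = lawMean ν (fun y => lawMean μ (fun x => h (x, y))) := by
  simp only [lawMean]
  rw [Fintype.sum_prod_type, sum_comm]
  refine sum_congr rfl fun y _ => ?_
  rw [mul_sum]
  exact sum_congr rfl fun x _ => by ring

/-- **LEMMA 22.13.**  If `μ` (on `X`) and `ν` (on `Y`) are non-negative laws with positive
correlations, then the product law `μ × ν` on `X × Y` with the coordinate-wise order has positive
correlations: for increasing `f, g` on `X × Y` and fixed `y`, `∫ f(·,y) g(·,y) dμ ≥ F(y) G(y)` (22.3)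
with `F, G` the increasing sections means, then integrate in `ν` (22.4) and use the positive
correlations of `ν` (22.5). [cite: LevinPeres2017, §22.4 Lemma 22.13, eqs. (22.3)–(22.5)] -/
theorem LevinPeres2017_lemma_22_13 {μ : X → ℝ} {ν : Y → ℝ} (hμ0 : ∀ x, 0 ≤ μ x) (hν0 : ∀ y, 0 ≤ ν y)
    (hμ : HasPositiveCorrelations μ) (hν : HasPositiveCorrelations ν) :
    HasPositiveCorrelations (fun p : X × Y => μ p.1 * ν p.2) := by
  intro f g hf hg
  -- section means `F(y) = ∫ f(x,y) μ(dx)`, `G(y) = ∫ g(x,y) μ(dx)`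
  set F : Y → ℝ := fun y => lawMean μ (fun x => f (x, y)) with hF
  set G : Y → ℝ := fun y => lawMean μ (fun x => g (x, y)) with hG
  have hfx : ∀ y, Monotone (fun x => f (x, y)) := fun y x x' hxx' => hf (Prod.mk_le_mk.mpr ⟨hxx', le_rfl⟩)
  have hgx : ∀ y, Monotone (fun x => g (x, y)) := fun y x x' hxx' => hg (Prod.mk_le_mk.mpr ⟨hxx', le_rfl⟩)
  have hFmono : Monotone F := fun y y' hyy' =>
    lawMean_mono hμ0 fun x => hf (Prod.mk_le_mk.mpr ⟨le_rfl, hyy'⟩)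
  have hGmono : Monotone G := fun y y' hyy' =>
    lawMean_mono hμ0 fun x => hg (Prod.mk_le_mk.mpr ⟨le_rfl, hyy'⟩)
  -- (22.3): for each `y`, `F(y) G(y) ≤ ∫ f(·,y) g(·,y) dμ`
  have h223 : ∀ y, F y * G y ≤ lawMean μ (fun x => f (x, y) * g (x, y)) := fun y =>
    hμ _ _ (hfx y) (hgx y)
  -- (22.4): integrate against `ν`
  have h224 : lawMean ν (fun y => F y * G y)
      ≤ lawMean (fun p : X × Y => μ p.1 * ν p.2) (fun p => f p * g p) := by
    rw [lawMean_prod]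
    exact lawMean_mono hν0 h223
  -- (22.5): positive correlations of `ν` for the increasing `F, G`
  have h225 : lawMean ν F * lawMean ν G ≤ lawMean ν (fun y => F y * G y) := hν F G hFmono hGmono
  calc lawMean (fun p : X × Y => μ p.1 * ν p.2) f * lawMean (fun p : X × Y => μ p.1 * ν p.2) g
      = lawMean ν F * lawMean ν G := by rw [lawMean_prod, lawMean_prod]
    _ ≤ lawMean ν (fun y => F y * G y) := h225
    _ ≤ lawMean (fun p : X × Y => μ p.1 * ν p.2) (fun p => f p * g p) := h224

end Product

/-! ## Lemma 22.14 (Harris): product laws on products of chains -/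

section Harris

variable {ι : Type*} [Fintype ι] [DecidableEq ι] {α : ι → Type*} [∀ i, LinearOrder (α i)]
  [∀ i, Fintype (α i)]

omit [Fintype ι] [DecidableEq ι] [∀ i, Fintype (α i)] in
/-- On a chain, `{a ∧ b, a ∨ b} = {a, b}`, so `m(a ∧ b) m(a ∨ b) = m(a) m(b)`.
[cite: FortuinKasteleynGinibreCMP1971, §1 (a totally ordered `Γ`: condition (A) holds trivially)] -/
theorem weight_inf_mul_weight_sup (i : ι) (m : α i → ℝ) (a b : α i) :
    m (a ⊓ b) * m (a ⊔ b) = m a * m b := by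
  rcases le_total a b with h | h
  · rw [inf_eq_left.mpr h, sup_eq_right.mpr h]
  · rw [inf_eq_right.mpr h, sup_eq_left.mpr h, mul_comm]

omit [DecidableEq ι] [∀ i, Fintype (α i)] in
/-- A product weight `μ(x) = Π_i m_i(x_i)` on a product of chains satisfies FKG's lattice condition (A)
with equality: `μ(x ∧ y) μ(x ∨ y) = μ(x) μ(y)`. [cite: FortuinKasteleynGinibreCMP1971, §1 ("Harris'
inequality as special case") with §2 condition (A)] -/
theorem prod_weight_latticeCondition (m : ∀ i, α i → ℝ) (x y : ∀ i, α i) :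
    (∏ i, m i (x i)) * ∏ i, m i (y i) = (∏ i, m i ((x ⊓ y) i)) * ∏ i, m i ((x ⊔ y) i) := by
  rw [← prod_mul_distrib, ← prod_mul_distrib]
  refine prod_congr rfl fun i _ => ?_
  rw [Pi.inf_apply, Pi.sup_apply, weight_inf_mul_weight_sup i (m i)]

omit [DecidableEq ι] in
/-- **LEMMA 22.14 (Harris inequality), unnormalised form**: for a product weight
`μ(x) = Π_i m_i(x_i)` with `m_i ≥ 0` on a product `Π_i X_i` of totally ordered finite sets
(coordinate-wise order), `(Σ μ f)(Σ μ g) ≤ (Σ μ)(Σ μ fg)` for increasing `f, g` — FKG's Proposition 1,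
condition (A) holding with equality. [cite: LevinPeres2017, §22.4 Lemma 22.14]
[cite: FortuinKasteleynGinibreCMP1971, §2 Prop. 1] -/
theorem LevinPeres2017_lemma_22_14_sum [DecidableEq ι] (m : ∀ i, α i → ℝ) (hm0 : ∀ i a, 0 ≤ m i a)
    {f g : (∀ i, α i) → ℝ} (hf : Monotone f) (hg : Monotone g) :
    (∑ x, (∏ i, m i (x i)) * f x) * (∑ x, (∏ i, m i (x i)) * g x)
      ≤ (∑ x : ∀ i, α i, ∏ i, m i (x i)) * ∑ x, (∏ i, m i (x i)) * (f x * g x) :=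
  FortuinKasteleynGinibre1971_prop_1 (μ := fun x : ∀ i, α i => ∏ i, m i (x i))
    (fun x => prod_nonneg fun i _ => hm0 i (x i))
    (fun x y => (prod_weight_latticeCondition m x y).le) hf hg

omit [DecidableEq ι] [∀ i, LinearOrder (α i)] in
/-- The product of probability vectors is a probability vector: `Σ_x Π_i m_i(x_i) = Π_i Σ m_i = 1`.
[folklore] -/
private theorem sum_prod_weight_eq_one [DecidableEq ι] (m : ∀ i, α i → ℝ) (hm1 : ∀ i, ∑ a, m i a = 1) :
    ∑ x : ∀ i, α i, ∏ i, m i (x i) = 1 := by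
  rw [← Fintype.prod_sum (fun i a => m i a)]
  exact prod_eq_one fun i _ => hm1 i

omit [DecidableEq ι] in
/-- **LEMMA 22.14 (Harris inequality).**  Let `X = X₁ × ⋯ × X_n` where each `X_i` is totally
ordered.  Using the coordinate-wise partial order on the product, any product probability on `X` has
positive correlations. [cite: LevinPeres2017, §22.4 Lemma 22.14] -/
theorem LevinPeres2017_lemma_22_14 [DecidableEq ι] (m : ∀ i, α i → ℝ) (hm0 : ∀ i a, 0 ≤ m i a)
    (hm1 : ∀ i, ∑ a, m i a = 1) :
    HasPositiveCorrelations (fun x : ∀ i, α i => ∏ i, m i (x i)) := by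
  intro f g hf hg
  have h := LevinPeres2017_lemma_22_14_sum m hm0 hf hg
  simpa only [lawMean, sum_prod_weight_eq_one m hm1, one_mul] using h

end Harris

end Literature.Probability.MarkovChains
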